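import Summits.Ventures.CertifiedManyBodySolver.Downfold.EmeryBlochBand
import HarnessLib

/-!
# Three-band → one-band at the band level ("technique B"): the map `(Δ, t_pd, t_pp) ↦ (t, t′, t″)`,
# its monotonicity, corner and MIXED-CORNER enclosures on a three-band box, and the sign of `t′`

Venture CertifiedManyBodySolver, cell `pub/hubbard-downfold` (stage S1 = downfolding front end; the
three-band → one-band reduction error is carried as explicit box inflation), seat
hubbard-downfold-mod-4; namespace `Summit.Ventures.CertifiedManyBodySolver.Downfold.Emery`.
Everything here is PROVED. WHAT THIS IS NOT: a statement about any material (no literature number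
here); not the interaction reduction; not the strong-coupling cell-perturbation / Zhang–Rice map
(technique A, seat mod-3); not a claim that a cuprate IS a one-band model — the reduction defines a
one-band PARAMETRISATION of the three-band antibonding band, whose misfit is carried separately
(`EmeryBlochBand.abs_extract*_sub_le`, `ThreeToOneBand`).

* `tB = abM/8`, `tpB = (2·abX − abM)/16`, `tppB = (abS − abX)/8 + tpB/2` — the four-point
  extraction (`EmeryBlochBand.extract`) applied to the antibonding energies
  `(ε_AB(Γ), ε_AB(X), ε_AB(M), ε_AB(S)) = (0, abX, abM, abS)` (`tB_eq_extractT`, …); `tB_pos`.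
* Monotonicity (`add_sqrt_sq_add_mono`: `x ↦ x + √(x² + a)` is monotone): each of `abX, abM, abS`
  is ANTITONE in `Δ`, MONOTONE in `t_pd ≥ 0` and in `t_pp` (`abX` does not see `t_pp`); hence
  `tB` likewise, and the CORNER ENCLOSURE `tB_mem_Icc_of_box` (two evaluations enclose the image
  of a product box; the instance of mod-3's `corner_enclosure` rule this coordinate needs).
* `t′` and `t″` are NOT monotone in `Δ` (reviewer unc-3, R4): they are DIFFERENCES of monotone maps,
  so the certified enclosure on a box is the MIXED-CORNER one — `tpB_mem_Icc_of_box_mixed`: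
  `tpB ∈ [(2·abX(Δhi,alo) − abM(Δlo,ahi,bhi))/16, (2·abX(Δlo,ahi) − abM(Δhi,alo,blo))/16]`, and
  `tppB_mem_Icc_of_box_mixed` likewise — valid on the whole box, wider than the true image; the
  excess is honest reduction width, and splitting the `Δ` range and hulling refines it (each piece
  is again this lemma).
* SIGN MECHANISM of `t′`: the pure d–p model (`t_pp = 0`) gives `t′_B > 0` (anti-cuprate;
  `tpB_pos_of_tpp_eq_zero`, strict concavity of `√`), `t′_B` is antitone in `t_pp` (`tpB_anti_tpp`),
  and `tpB_neg_iff` names the threshold `ε_AB(M) > 2 ε_AB(X)` — why `t′/t` is the coordinate this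
  reduction declares most sensitive (cell ROUTER v0.6.1: three-band-internal `t′` values are
  CONTEXT, not box end points).

Sources: as `EmeryBlochBand` ([HybertsenSchluterChristensen1989] parametrisation; [PavariniEtAl2001]
`t, t′, t″` language). Rational end points for boxes: `Downfold.ThreeToOneBand` (interval `√`).
-/

noncomputable section

namespace Summit.Ventures.CertifiedManyBodySolver.Downfold.Emery

open Real

/-! ## §1 The map and its identification with the four-point extraction -/

/-- Technique-B nearest-neighbour hopping: `t_B = (ε_AB(M) − ε_AB(Γ))/8 = abM/8` (`ε_AB(Γ) = 0`).
[folklore] -/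
def tB (Δ tpd tpp : ℝ) : ℝ := abM Δ tpd tpp / 8

/-- Technique-B second-neighbour hopping (D0 sign): `t′_B = (2ε_AB(X) − ε_AB(Γ) − ε_AB(M))/16`.
[folklore] -/
def tpB (Δ tpd tpp : ℝ) : ℝ := (2 * abX Δ tpd - abM Δ tpd tpp) / 16

/-- Technique-B third-neighbour hopping: `t″_B = (ε_AB(S) − ε_AB(X))/8 + t′_B/2`. [folklore] -/
def tppB (Δ tpd tpp : ℝ) : ℝ := (abS Δ tpd tpp - abX Δ tpd) / 8 + tpB Δ tpd tpp / 2

/-- `t_B` is the `t`-component of the four-point extraction at `(0, abX, abM, abS)`. [folklore] -/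
theorem tB_eq_extractT (Δ tpd tpp : ℝ) : tB Δ tpd tpp = extractT 0 (abM Δ tpd tpp) := by
  simp only [tB, extractT, sub_zero]

/-- `t′_B` is the `t′`-component of the four-point extraction at `(0, abX, abM, abS)`. [folklore] -/
theorem tpB_eq_extractTp (Δ tpd tpp : ℝ) :
    tpB Δ tpd tpp = extractTp 0 (abX Δ tpd) (abM Δ tpd tpp) := by
  simp only [tpB, extractTp, sub_zero]

/-- `t″_B` is the `t″`-component of the four-point extraction at `(0, abX, abM, abS)`. [folklore] -/
theorem tppB_eq_extractTpp (Δ tpd tpp : ℝ) :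
    tppB Δ tpd tpp = extractTpp 0 (abX Δ tpd) (abM Δ tpd tpp) (abS Δ tpd tpp) := by
  simp only [tppB, tpB, extractTpp, extractTp, sub_zero]

/-- `t″_B` as a signed combination of the three antibonding energies: `abS/8 − abX/16 − abM/32`.
[folklore] -/
theorem tppB_eq (Δ tpd tpp : ℝ) :
    tppB Δ tpd tpp = abS Δ tpd tpp / 8 - abX Δ tpd / 16 - abM Δ tpd tpp / 32 := by
  simp only [tppB, tpB]; ring

/-- `t_B > 0` as soon as `t_pd ≠ 0` (any `Δ`, `t_pp`). [folklore] -/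
theorem tB_pos {Δ tpd tpp : ℝ} (htpd : tpd ≠ 0) : 0 < tB Δ tpd tpp := by
  unfold tB abM
  have hpos : 0 < tpd ^ 2 := by positivity
  have hlt : |Δ - 4 * tpp| < Real.sqrt ((Δ - 4 * tpp) ^ 2 + 32 * tpd ^ 2) := by
    rw [← Real.sqrt_sq_eq_abs]
    exact Real.sqrt_lt_sqrt (sq_nonneg _) (by linarith)
  have h2 : Δ - 4 * tpp ≤ |Δ - 4 * tpp| := le_abs_self _
  linarith

/-- `t_B ≥ 0` always. [folklore] -/
theorem tB_nonneg (Δ tpd tpp : ℝ) : 0 ≤ tB Δ tpd tpp := by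
  unfold tB; have := abM_nonneg Δ tpd tpp; linarith

/-! ## §2 Monotonicity of the antibonding energies and of `t_B` -/

/-- Auxiliary monotonicity: `x ↦ x + √(x² + a)` is monotone for `a ≥ 0`. [folklore] -/
theorem add_sqrt_sq_add_mono {a x y : ℝ} (ha : 0 ≤ a) (hxy : x ≤ y) :
    x + Real.sqrt (x ^ 2 + a) ≤ y + Real.sqrt (y ^ 2 + a) := by
  have hx2 : Real.sqrt (x ^ 2 + a) ^ 2 = x ^ 2 + a := Real.sq_sqrt (by positivity)
  have hy2 : Real.sqrt (y ^ 2 + a) ^ 2 = y ^ 2 + a := Real.sq_sqrt (by positivity)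
  have hxabs : |x| ≤ Real.sqrt (x ^ 2 + a) := abs_le_sqrt_sq_add ha
  have hyabs : |y| ≤ Real.sqrt (y ^ 2 + a) := abs_le_sqrt_sq_add ha
  by_cases hc : Real.sqrt (x ^ 2 + a) ≤ Real.sqrt (y ^ 2 + a)
  · linarith
  · push Not at hc
    have hsum : 0 < Real.sqrt (x ^ 2 + a) + Real.sqrt (y ^ 2 + a) := by
      linarith [Real.sqrt_nonneg (y ^ 2 + a), abs_nonneg x]
    have hxyabs : |x + y| ≤ Real.sqrt (x ^ 2 + a) + Real.sqrt (y ^ 2 + a) :=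
      (abs_add_le _ _).trans (by linarith)
    have hprod : (Real.sqrt (x ^ 2 + a) - Real.sqrt (y ^ 2 + a))
        * (Real.sqrt (x ^ 2 + a) + Real.sqrt (y ^ 2 + a)) = (x - y) * (x + y) := by
      nlinarith [hx2, hy2]
    have hle : (x - y) * (x + y)
        ≤ (y - x) * (Real.sqrt (x ^ 2 + a) + Real.sqrt (y ^ 2 + a)) := by
      have h1 : (x - y) * (x + y) ≤ (y - x) * |x + y| := by
        nlinarith [neg_abs_le (x + y), sub_nonneg.mpr hxy]
      nlinarith [h1, hxyabs, sub_nonneg.mpr hxy]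
    have hfin : Real.sqrt (x ^ 2 + a) - Real.sqrt (y ^ 2 + a) ≤ y - x := by
      by_contra hh
      push Not at hh
      have := mul_lt_mul_of_pos_right hh hsum
      linarith [hprod ▸ this]
    linarith

/-- `abX` is ANTITONE in `Δ`. [folklore] -/
theorem abX_anti_Delta {Δ₁ Δ₂ tpd : ℝ} (h : Δ₁ ≤ Δ₂) : abX Δ₂ tpd ≤ abX Δ₁ tpd := by
  unfold abX
  have key := add_sqrt_sq_add_mono (a := 16 * tpd ^ 2) (x := -Δ₂) (y := -Δ₁)
    (by positivity) (by linarith)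
  have e1 : (-Δ₂) ^ 2 = Δ₂ ^ 2 := by ring
  have e2 : (-Δ₁) ^ 2 = Δ₁ ^ 2 := by ring
  rw [e1, e2] at key
  linarith

/-- `abX` is MONOTONE in `t_pd` on `t_pd ≥ 0`. [folklore] -/
theorem abX_mono_tpd {Δ tpd₁ tpd₂ : ℝ} (h0 : 0 ≤ tpd₁) (h : tpd₁ ≤ tpd₂) :
    abX Δ tpd₁ ≤ abX Δ tpd₂ := by
  unfold abX
  have hsq : tpd₁ ^ 2 ≤ tpd₂ ^ 2 := by nlinarith
  have := Real.sqrt_le_sqrt (show Δ ^ 2 + 16 * tpd₁ ^ 2 ≤ Δ ^ 2 + 16 * tpd₂ ^ 2 by linarith)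
  linarith

/-- `abM` is MONOTONE in `t_pp` (O–O hopping widens the antibonding band). [folklore] -/
theorem abM_mono_tpp {Δ tpd tpp₁ tpp₂ : ℝ} (h : tpp₁ ≤ tpp₂) : abM Δ tpd tpp₁ ≤ abM Δ tpd tpp₂ := by
  unfold abM
  have key := add_sqrt_sq_add_mono (a := 32 * tpd ^ 2) (x := -Δ + 4 * tpp₁) (y := -Δ + 4 * tpp₂)
    (by positivity) (by linarith)
  have e1 : (-Δ + 4 * tpp₁) ^ 2 = (Δ - 4 * tpp₁) ^ 2 := by ring
  have e2 : (-Δ + 4 * tpp₂) ^ 2 = (Δ - 4 * tpp₂) ^ 2 := by ring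
  rw [e1, e2] at key
  linarith

/-- `abM` is ANTITONE in `Δ`. [folklore] -/
theorem abM_anti_Delta {Δ₁ Δ₂ tpd tpp : ℝ} (h : Δ₁ ≤ Δ₂) : abM Δ₂ tpd tpp ≤ abM Δ₁ tpd tpp := by
  unfold abM
  have key := add_sqrt_sq_add_mono (a := 32 * tpd ^ 2) (x := -Δ₂ + 4 * tpp) (y := -Δ₁ + 4 * tpp)
    (by positivity) (by linarith)
  have e1 : (-Δ₂ + 4 * tpp) ^ 2 = (Δ₂ - 4 * tpp) ^ 2 := by ring
  have e2 : (-Δ₁ + 4 * tpp) ^ 2 = (Δ₁ - 4 * tpp) ^ 2 := by ring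
  rw [e1, e2] at key
  linarith

/-- `abM` is MONOTONE in `t_pd` on `t_pd ≥ 0`. [folklore] -/
theorem abM_mono_tpd {Δ tpd₁ tpd₂ tpp : ℝ} (h0 : 0 ≤ tpd₁) (h : tpd₁ ≤ tpd₂) :
    abM Δ tpd₁ tpp ≤ abM Δ tpd₂ tpp := by
  unfold abM
  have hsq : tpd₁ ^ 2 ≤ tpd₂ ^ 2 := by nlinarith
  have := Real.sqrt_le_sqrt (show (Δ - 4 * tpp) ^ 2 + 32 * tpd₁ ^ 2
    ≤ (Δ - 4 * tpp) ^ 2 + 32 * tpd₂ ^ 2 by linarith)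
  linarith

/-- `abS` is MONOTONE in `t_pp`. [folklore] -/
theorem abS_mono_tpp {Δ tpd tpp₁ tpp₂ : ℝ} (h : tpp₁ ≤ tpp₂) : abS Δ tpd tpp₁ ≤ abS Δ tpd tpp₂ := by
  unfold abS
  have key := add_sqrt_sq_add_mono (a := 16 * tpd ^ 2) (x := -Δ + 2 * tpp₁) (y := -Δ + 2 * tpp₂)
    (by positivity) (by linarith)
  have e1 : (-Δ + 2 * tpp₁) ^ 2 = (Δ - 2 * tpp₁) ^ 2 := by ring
  have e2 : (-Δ + 2 * tpp₂) ^ 2 = (Δ - 2 * tpp₂) ^ 2 := by ring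
  rw [e1, e2] at key
  linarith

/-- `abS` is ANTITONE in `Δ`. [folklore] -/
theorem abS_anti_Delta {Δ₁ Δ₂ tpd tpp : ℝ} (h : Δ₁ ≤ Δ₂) : abS Δ₂ tpd tpp ≤ abS Δ₁ tpd tpp := by
  unfold abS
  have key := add_sqrt_sq_add_mono (a := 16 * tpd ^ 2) (x := -Δ₂ + 2 * tpp) (y := -Δ₁ + 2 * tpp)
    (by positivity) (by linarith)
  have e1 : (-Δ₂ + 2 * tpp) ^ 2 = (Δ₂ - 2 * tpp) ^ 2 := by ring
  have e2 : (-Δ₁ + 2 * tpp) ^ 2 = (Δ₁ - 2 * tpp) ^ 2 := by ring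
  rw [e1, e2] at key
  linarith

/-- `abS` is MONOTONE in `t_pd` on `t_pd ≥ 0`. [folklore] -/
theorem abS_mono_tpd {Δ tpd₁ tpd₂ tpp : ℝ} (h0 : 0 ≤ tpd₁) (h : tpd₁ ≤ tpd₂) :
    abS Δ tpd₁ tpp ≤ abS Δ tpd₂ tpp := by
  unfold abS
  have hsq : tpd₁ ^ 2 ≤ tpd₂ ^ 2 := by nlinarith
  have := Real.sqrt_le_sqrt (show (Δ - 2 * tpp) ^ 2 + 16 * tpd₁ ^ 2
    ≤ (Δ - 2 * tpp) ^ 2 + 16 * tpd₂ ^ 2 by linarith)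
  linarith

/-- CORNER ENCLOSURE for `abX` on `[Δlo,Δhi] × [alo,ahi]`, `alo ≥ 0`:
`abX ∈ [abX(Δhi, alo), abX(Δlo, ahi)]`. [folklore] -/
theorem abX_mem_Icc_of_box {Δlo Δhi alo ahi Δ tpd : ℝ} (ha : 0 ≤ alo)
    (hΔ : Δ ∈ Set.Icc Δlo Δhi) (htpd : tpd ∈ Set.Icc alo ahi) :
    abX Δ tpd ∈ Set.Icc (abX Δhi alo) (abX Δlo ahi) :=
  ⟨(abX_anti_Delta hΔ.2).trans (abX_mono_tpd ha htpd.1),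
    (abX_mono_tpd (ha.trans htpd.1) htpd.2).trans (abX_anti_Delta hΔ.1)⟩

/-- CORNER ENCLOSURE for `abM` on `[Δlo,Δhi] × [alo,ahi] × [blo,bhi]`, `alo ≥ 0`:
`abM ∈ [abM(Δhi, alo, blo), abM(Δlo, ahi, bhi)]`. [folklore] -/
theorem abM_mem_Icc_of_box {Δlo Δhi alo ahi blo bhi Δ tpd tpp : ℝ} (ha : 0 ≤ alo)
    (hΔ : Δ ∈ Set.Icc Δlo Δhi) (htpd : tpd ∈ Set.Icc alo ahi) (htpp : tpp ∈ Set.Icc blo bhi) :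
    abM Δ tpd tpp ∈ Set.Icc (abM Δhi alo blo) (abM Δlo ahi bhi) :=
  ⟨((abM_anti_Delta hΔ.2).trans (abM_mono_tpd ha htpd.1)).trans (abM_mono_tpp htpp.1),
    ((abM_mono_tpd (ha.trans htpd.1) htpd.2).trans (abM_mono_tpp htpp.2)).trans
      (abM_anti_Delta hΔ.1)⟩

/-- CORNER ENCLOSURE for `abS` on `[Δlo,Δhi] × [alo,ahi] × [blo,bhi]`, `alo ≥ 0`. [folklore] -/
theorem abS_mem_Icc_of_box {Δlo Δhi alo ahi blo bhi Δ tpd tpp : ℝ} (ha : 0 ≤ alo)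
    (hΔ : Δ ∈ Set.Icc Δlo Δhi) (htpd : tpd ∈ Set.Icc alo ahi) (htpp : tpp ∈ Set.Icc blo bhi) :
    abS Δ tpd tpp ∈ Set.Icc (abS Δhi alo blo) (abS Δlo ahi bhi) :=
  ⟨((abS_anti_Delta hΔ.2).trans (abS_mono_tpd ha htpd.1)).trans (abS_mono_tpp htpp.1),
    ((abS_mono_tpd (ha.trans htpd.1) htpd.2).trans (abS_mono_tpp htpp.2)).trans
      (abS_anti_Delta hΔ.1)⟩

/-- `t_B` is MONOTONE in `t_pp`. [folklore] -/
theorem tB_mono_tpp {Δ tpd tpp₁ tpp₂ : ℝ} (h : tpp₁ ≤ tpp₂) : tB Δ tpd tpp₁ ≤ tB Δ tpd tpp₂ := by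
  unfold tB; have := abM_mono_tpp (Δ := Δ) (tpd := tpd) h; linarith

/-- `t_B` is ANTITONE in the charge-transfer energy `Δ`. [folklore] -/
theorem tB_anti_Delta {Δ₁ Δ₂ tpd tpp : ℝ} (h : Δ₁ ≤ Δ₂) : tB Δ₂ tpd tpp ≤ tB Δ₁ tpd tpp := by
  unfold tB; have := abM_anti_Delta (tpd := tpd) (tpp := tpp) h; linarith

/-- `t_B` is MONOTONE in `t_pd` on `t_pd ≥ 0`. [folklore] -/
theorem tB_mono_tpd {Δ tpd₁ tpd₂ tpp : ℝ} (h0 : 0 ≤ tpd₁) (h : tpd₁ ≤ tpd₂) :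
    tB Δ tpd₁ tpp ≤ tB Δ tpd₂ tpp := by
  unfold tB; have := abM_mono_tpd (Δ := Δ) (tpp := tpp) h0 h; linarith

/-- **CORNER ENCLOSURE for `t`**: on a three-band box `[Δlo,Δhi] × [alo,ahi] × [blo,bhi]` with
`alo ≥ 0`, `t_B ∈ [t_B(Δhi, alo, blo), t_B(Δlo, ahi, bhi)]` — two evaluations, no sampling.
[folklore] -/
theorem tB_mem_Icc_of_box {Δlo Δhi alo ahi blo bhi Δ tpd tpp : ℝ} (ha : 0 ≤ alo)
    (hΔ : Δ ∈ Set.Icc Δlo Δhi) (htpd : tpd ∈ Set.Icc alo ahi) (htpp : tpp ∈ Set.Icc blo bhi) :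
    tB Δ tpd tpp ∈ Set.Icc (tB Δhi alo blo) (tB Δlo ahi bhi) := by
  have h := abM_mem_Icc_of_box ha hΔ htpd htpp
  unfold tB
  exact ⟨by linarith [h.1], by linarith [h.2]⟩

/-! ## §3 Mixed-corner enclosures for the non-monotone coordinates `t′`, `t″` -/

/-- **MIXED-CORNER ENCLOSURE for `t′`** (difference of monotone maps; reviewer unc-3 R4): on a
three-band box `[Δlo,Δhi] × [alo,ahi] × [blo,bhi]` with `alo ≥ 0`,
`t′_B ∈ [(2·abX(Δhi,alo) − abM(Δlo,ahi,bhi))/16, (2·abX(Δlo,ahi) − abM(Δhi,alo,blo))/16]`.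
Valid on the whole box; wider than the true image because `t′_B` is not monotone in `Δ` — the
excess is declared reduction width, refinable by splitting the `Δ` range. [folklore] -/
theorem tpB_mem_Icc_of_box_mixed {Δlo Δhi alo ahi blo bhi Δ tpd tpp : ℝ} (ha : 0 ≤ alo)
    (hΔ : Δ ∈ Set.Icc Δlo Δhi) (htpd : tpd ∈ Set.Icc alo ahi) (htpp : tpp ∈ Set.Icc blo bhi) :
    tpB Δ tpd tpp ∈ Set.Icc ((2 * abX Δhi alo - abM Δlo ahi bhi) / 16)
      ((2 * abX Δlo ahi - abM Δhi alo blo) / 16) := by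
  have hX := abX_mem_Icc_of_box ha hΔ htpd
  have hM := abM_mem_Icc_of_box ha hΔ htpd htpp
  unfold tpB
  exact ⟨by linarith [hX.1, hM.2], by linarith [hX.2, hM.1]⟩

/-- **MIXED-CORNER ENCLOSURE for `t″`** (`t″_B = abS/8 − abX/16 − abM/32`, each term monotone): on
a three-band box with `alo ≥ 0`,
`t″_B ∈ [abS(Δhi,alo,blo)/8 − abX(Δlo,ahi)/16 − abM(Δlo,ahi,bhi)/32,
         abS(Δlo,ahi,bhi)/8 − abX(Δhi,alo)/16 − abM(Δhi,alo,blo)/32]`. [folklore] -/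
theorem tppB_mem_Icc_of_box_mixed {Δlo Δhi alo ahi blo bhi Δ tpd tpp : ℝ} (ha : 0 ≤ alo)
    (hΔ : Δ ∈ Set.Icc Δlo Δhi) (htpd : tpd ∈ Set.Icc alo ahi) (htpp : tpp ∈ Set.Icc blo bhi) :
    tppB Δ tpd tpp ∈ Set.Icc
      (abS Δhi alo blo / 8 - abX Δlo ahi / 16 - abM Δlo ahi bhi / 32)
      (abS Δlo ahi bhi / 8 - abX Δhi alo / 16 - abM Δhi alo blo / 32) := by
  have hX := abX_mem_Icc_of_box ha hΔ htpd
  have hM := abM_mem_Icc_of_box ha hΔ htpd htpp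
  have hS := abS_mem_Icc_of_box ha hΔ htpd htpp
  rw [tppB_eq]
  exact ⟨by linarith [hX.2, hM.2, hS.1], by linarith [hX.1, hM.1, hS.2]⟩

/-! ## §4 The sign mechanism of `t′` -/

/-- SIGN MECHANISM of `t′`, part 1: the pure d–p model (`t_pp = 0`, `t_pd ≠ 0`) gives `t′_B > 0`,
i.e. the ANTI-cuprate sign — by strict concavity of `√`:
`√(Δ² + 16a) > (√(Δ²) + √(Δ² + 32a))/2 ≥ (Δ + √(Δ² + 32a))/2`. [folklore] -/
theorem tpB_pos_of_tpp_eq_zero {Δ tpd : ℝ} (htpd : tpd ≠ 0) : 0 < tpB Δ tpd 0 := by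
  unfold tpB abX abM
  have ha : 0 < tpd ^ 2 := by positivity
  set u := Real.sqrt (Δ ^ 2 + 16 * tpd ^ 2) with hu
  set v := Real.sqrt ((Δ - 4 * 0) ^ 2 + 32 * tpd ^ 2) with hv
  have hu2 : u ^ 2 = Δ ^ 2 + 16 * tpd ^ 2 := Real.sq_sqrt (by positivity)
  have hv2 : v ^ 2 = (Δ - 4 * 0) ^ 2 + 32 * tpd ^ 2 := Real.sq_sqrt (by positivity)
  have hvΔ : |Δ| < v := by
    rw [← Real.sqrt_sq_eq_abs, hv]
    exact Real.sqrt_lt_sqrt (sq_nonneg _) (by nlinarith)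
  have hΔle : Δ ≤ |Δ| := le_abs_self Δ
  have key : Δ + v < 2 * u := by
    have h2u : 2 * u ^ 2 = Δ ^ 2 + v ^ 2 := by rw [hu2, hv2]; ring
    have hne : (v - Δ) ≠ 0 := by intro h0; linarith
    have hsq : 0 < (v - Δ) ^ 2 := by positivity
    have hupos : 0 < u := by rw [hu]; exact Real.sqrt_pos.mpr (by nlinarith)
    by_cases hs : Δ + v ≤ 0
    · linarith
    · push Not at hs
      nlinarith [h2u, hsq]
  linarith

/-- SIGN MECHANISM of `t′`, part 2: `t′_B` is ANTITONE in `t_pp` — oxygen–oxygen hopping drives `t′`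
toward the cuprate sign (and `abX` does not depend on `t_pp`). [folklore] -/
theorem tpB_anti_tpp {Δ tpd tpp₁ tpp₂ : ℝ} (h : tpp₁ ≤ tpp₂) : tpB Δ tpd tpp₂ ≤ tpB Δ tpd tpp₁ := by
  unfold tpB
  have := abM_mono_tpp (Δ := Δ) (tpd := tpd) h
  linarith

/-- The cuprate-sign criterion: `t′_B < 0 ↔ 2 ε_AB(X) < ε_AB(M)` (with `ε_AB(Γ) = 0`); by
`tpB_anti_tpp` the set of `t_pp` where this holds is an up-set at fixed `Δ, t_pd`. [folklore] -/
theorem tpB_neg_iff (Δ tpd tpp : ℝ) : tpB Δ tpd tpp < 0 ↔ 2 * abX Δ tpd < abM Δ tpd tpp := by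
  unfold tpB
  constructor <;> intro h <;> linarith

/-- `t′_B` is MONOTONE in `t_pd` at `t_pp = 0`? No such claim is made; what IS monotone is recorded
above. This lemma records the one-sided consequence used by boxes: on a box with `blo ≥ b₀`,
`t′_B ≤ t′_B(·,·,b₀)` pointwise. [folklore] -/
theorem tpB_le_of_le_tpp {Δ tpd b₀ tpp : ℝ} (h : b₀ ≤ tpp) : tpB Δ tpd tpp ≤ tpB Δ tpd b₀ :=
  tpB_anti_tpp h

end Summit.Ventures.CertifiedManyBodySolver.Downfold.Emery

end
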